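import Literature.NumberTheory.GaloisRepresentations.IdeleBarKS
import Literature.NumberTheory.GaloisRepresentations.IdeleClassBarKS
import Literature.NumberTheory.GaloisRepresentations.GalLayerSystemSES
import HarnessLib

/-!
# The maps around `I_S` in `Rep ℤ G_S`: `I_S ↪ J_{K_S}`, `J_{K_S} → C_{K_S}`, `I_S → C_{K_S}`, and Harari's unit
# embedding `E_{K_S} → J_{K_S} ↠ I_S` (Harari, *Galois Cohomology and CFT*, §17.4 (17.1))

Topic `NumberTheory/GaloisRepresentations`; namespace `Literature.NumberTheory.GaloisRepresentations.IdeleClassBar`;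
sequel to `IdeleBarKS.lean` (`ideleBarKS = J̄^{N_S}`, `truncKS : J_{K_S} ↠ I_S`), -w3 g17's `IdeleClassBarKS.lean`
(`classBarKS = C̄^{N_S}`) and door-c5's `GalLayerSystemSES.lean` (`unitsToIdele`, `ideleToClass`).  Definitions with
bodies and theorems; NO named fact, no `sorry`, no instance, no notation; number fields in `Type`.

THE POINT.  Harari's (17.1) `0 → E_S → I_S → C_S → 0` is assembled in `Rep ℤ G_S` from door-c5's system morphisms
`Eˣ → J_E → C_E` by taking `N_S`-invariants of the limits (door-c4's `invariantsQuotFunctor`) and composing with the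
truncation `J_{K_S} ↠ I_S` / the inclusion `I_S ↪ J_{K_S}`: `E_{K_S} := (lim Eˣ)^{N_S} → J_{K_S} ↠ I_S`
(`unitsToTruncKS`) and `I_S ↪ J_{K_S} → C_{K_S}` (`truncIdeleBarToClassKS`); the further quotient `C_{K_S} ↠ C̄_S`
(by `Ū_S`) is -w3 g17's `IdeleClassBarS.lean`.  Exactness statements are NOT in this file.

## What is formalised (`K : Type` a number field, `S : Finset (HeightOneSpectrum (𝓞 K))`)

* §1 `inclKSAddHom`, **`inclKS K S : truncIdeleBarRep K S ⟶ ideleBarKS K S`** (`I_S ↪ J_{K_S}`), `inclKS_hom_apply`,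
  `truncKSAddHom_inclKSAddHom` and **`inclKS_comp_truncKS : inclKS ≫ truncKS = 𝟙`** (the truncation splits the inclusion).
* §2 **`idelesToClassKS K S : ideleBarKS K S ⟶ classBarKS K S`** (`J_{K_S} → C_{K_S}`, invariants of door-c5's
  `ideleToClass`), `coe_idelesToClassKS_apply`, **`truncIdeleBarToClassKS K S : truncIdeleBarRep K S ⟶ classBarKS K S`**
  (`I_S → C_{K_S}`).
* §3 `unitsBarKS K S` (`E_{K_S} := (lim→ Eˣ)^{N_S} = K_Sˣ`), **`unitsToIdelesKS`** (`E_{K_S} → J_{K_S}`),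
  `coe_unitsToIdelesKS_apply`, **`unitsToTruncKS K S : unitsBarKS K S ⟶ truncIdeleBarRep K S`** (Harari's
  `E_S → I_S`: principal idèle, then truncate), `unitsToTruncKS_hom_apply`.

Written for lane «PT-Ш-S-TC» (brick D3) of crux `GoodLatticeBDPValue` (cell bsd-eis, item 19032), seat bsd-line-x1-p1-w6
gen 10.  HONEST FRAMING: bookkeeping; no arithmetic statement and no case of BSD is proved here.

## References
* D. Harari, *Galois Cohomology and Class Field Theory*, Universitext, Springer (2020), §17.4 (17.1), Lemma 15.39.
  [Harari2020]
* J. W. S. Cassels, A. Fröhlich (eds.), *Algebraic Number Theory* (1967), Ch. VII (J. Tate) §8, §9.7. [CasselsFrohlichANT1967]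
-/

noncomputable section

open NumberField IsDedekindDomain CategoryTheory
open Field (absoluteGaloisGroup)
open Literature.NumberTheory.Automorphic Literature.Algebra.Homology
open scoped Classical

namespace Literature.NumberTheory.GaloisRepresentations

namespace IdeleClassBar

variable (K : Type) [Field K] [NumberField K] (S : Finset (HeightOneSpectrum (𝓞 K)))

/-! ## §1. `I_S ↪ J_{K_S}` and its splitting by the truncation -/

/-- The inclusion `I_S → J̄^{N_S}` on underlying groups (`I_S` is `N_S`-fixed, `rep_eq_self_of_mem_ramificationSubgroup`).
[cite: Harari2020, §17.4 (17.1)] -/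
def inclKSAddHom : truncIdeleBar K S →+ (ideleBarKS K S).V where
  toFun z := ⟨(z.1 : (ideleData K).toSystem.limit), (mem_ideleInvariantsKS_iff_forall S _).2
    fun _ hσ => rep_eq_self_of_mem_ramificationSubgroup hσ z.2⟩
  map_zero' := Subtype.ext rfl
  map_add' _ _ := Subtype.ext rfl

/-- Formula. [cite: Harari2020, §17.4 (17.1)] -/
@[simp] theorem coe_inclKSAddHom_apply (z : truncIdeleBar K S) :
    ((inclKSAddHom K S z).1 : (ideleData K).toSystem.limit) = (z.1 : (ideleData K).toSystem.limit) := rfl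

/-- **`I_S ↪ J_{K_S}` as a morphism of `Rep ℤ G_S`.** [cite: Harari2020, §17.4 (17.1)] -/
def inclKS : truncIdeleBarRep K S ⟶ ideleBarKS K S :=
  letI : Module ℤ (ideleBarKS K S).V := (ideleBarKS K S).hV2
  Rep.ofHom
    ⟨{ toFun := inclKSAddHom K S
       map_add' := fun z z' => map_add _ z z'
       map_smul' := fun c z => by
         have h := map_intCast_smul (inclKSAddHom K S) ℤ ℤ c z
         rw [RingHom.id_apply]
         exact h },
      fun g => LinearMap.ext fun z => by
        obtain ⟨σ, rfl⟩ := QuotientGroup.mk_surjective g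
        exact Subtype.ext rfl⟩

/-- Formula (definitional). [cite: Harari2020, §17.4 (17.1)] -/
theorem inclKS_hom_apply (z : (truncIdeleBarRep K S).V) :
    (inclKS K S).hom z = (show (truncIdeleBarRep K S).V → (ideleBarKS K S).V from inclKSAddHom K S) z := rfl

/-- `trunc (incl z) = z` on underlying groups. [cite: Harari2020, §17.4 (17.1)] -/
theorem truncKSAddHom_inclKSAddHom (z : truncIdeleBar K S) : truncKSAddHom K S (inclKSAddHom K S z) = z :=
  Subtype.ext (truncBar_eq_self_of_mem z.2)

/-- **`I_S ↪ J_{K_S} ↠ I_S` is the identity**: the truncation splits the inclusion. [cite: Harari2020, §17.4 (17.1)] -/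
theorem inclKS_comp_truncKS : inclKS K S ≫ truncKS K S = 𝟙 (truncIdeleBarRep K S) :=
  Rep.hom_ext (DFunLike.ext _ _ fun z => truncKSAddHom_inclKSAddHom K S z)

/-! ## §2. `J_{K_S} → C_{K_S}` and `I_S → C_{K_S}` -/

/-- **`J_{K_S} → C_{K_S}`**: the `N_S`-invariants of door-c5's class map `J̄ → C̄`. [cite: Harari2020, §17.4 (17.1)]
[cite: CasselsFrohlichANT1967, Ch. VII §8] -/
def idelesToClassKS : ideleBarKS K S ⟶ classBarKS K S :=
  (DiscreteRep.invariantsQuotFunctor ℤ (ramificationSubgroup K (↑S : Set (HeightOneSpectrum (𝓞 K))))).map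
    (ideleToClass K).limitHom

/-- Formula: on vectors `J_{K_S} → C_{K_S}` is the limit class map. [cite: Harari2020, §17.4 (17.1)] -/
@[simp] theorem coe_idelesToClassKS_apply (z : (ideleBarKS K S).V) :
    (((idelesToClassKS K S).hom z).1 : classBar K) = (ideleToClass K).limitMap (z.1 : (ideleData K).toSystem.limit) :=
  rfl

/-- **`I_S → C_{K_S}`** (inclusion, then the class map; the PT map `I_S → C̄_S` of (17.1) is this followed by
-w3 g17's quotient `C_{K_S} ↠ C̄_S`). [cite: Harari2020, §17.4 (17.1)] -/
def truncIdeleBarToClassKS : truncIdeleBarRep K S ⟶ classBarKS K S := inclKS K S ≫ idelesToClassKS K S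

/-! ## §3. The unit embedding `E_{K_S} → J_{K_S} ↠ I_S` -/

/-- **`E_{K_S} := (lim→ Eˣ)^{N_S} = K_Sˣ` as a representation of `G_S`.** [cite: Harari2020, §17.4 (17.1)] -/
abbrev unitsBarKS : Rep ℤ (GaloisGroupUnramifiedOutside K (↑S : Set (HeightOneSpectrum (𝓞 K)))) :=
  (DiscreteRep.invariantsQuotFunctor ℤ (ramificationSubgroup K (↑S : Set (HeightOneSpectrum (𝓞 K))))).obj
    (unitsData K).toSystem.toD

/-- **`E_{K_S} → J_{K_S}`** (principal idèles; invariants of door-c5's `unitsToIdele`). [cite: Harari2020, §17.4 (17.1)] -/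
def unitsToIdelesKS : unitsBarKS K S ⟶ ideleBarKS K S :=
  (DiscreteRep.invariantsQuotFunctor ℤ (ramificationSubgroup K (↑S : Set (HeightOneSpectrum (𝓞 K))))).map
    (unitsToIdele K).limitHom

/-- Formula: on vectors `E_{K_S} → J_{K_S}` is the limit of the principal-idèle maps. [cite: Harari2020, §17.4 (17.1)] -/
@[simp] theorem coe_unitsToIdelesKS_apply (u : (unitsBarKS K S).V) :
    (((unitsToIdelesKS K S).hom u).1 : (ideleData K).toSystem.limit) =
      (unitsToIdele K).limitMap (u.1 : (unitsData K).toSystem.limit) := rfl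

/-- **Harari's `E_S → I_S`**: the principal idèle of an `S`-unit of `K_S`, truncated at `S`
(`a ↦ ((a)_{w ∣ S ∪ ∞}, (1)_{w ∤ S})`). [cite: Harari2020, Lemma 15.39 (proof), §17.4 (17.1)] -/
def unitsToTruncKS : unitsBarKS K S ⟶ truncIdeleBarRep K S := unitsToIdelesKS K S ≫ truncKS K S

/-- Formula: `unitsToTruncKS u = trunc (unitsToIdelesKS u)` (definitional). [cite: Harari2020, §17.4 (17.1)] -/
theorem unitsToTruncKS_hom_apply (u : (unitsBarKS K S).V) :
    (unitsToTruncKS K S).hom u =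
      (show (ideleBarKS K S).V → (truncIdeleBarRep K S).V from truncKSAddHom K S) ((unitsToIdelesKS K S).hom u) :=
  rfl

end IdeleClassBar

end Literature.NumberTheory.GaloisRepresentations

end
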